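import Literature.Probability.Percolation.NearCriticalRSWStart
import Literature.Probability.Percolation.KestenScalingFromFourFacts
import Literature.Probability.Percolation.HalfPlaneTwoArmRadiiNearCritical
import HarnessLib

/-!
# `ξ(p) = |p - 1/2|^{-4/3 + o(1)}` from the four-arm exponent and three near-critical facts (assembly, proofs only)

Topic `Literature/Probability/Percolation`; family `crit-perc`. The state of the discharge of the
named fact `Literature.Probability.Percolation.triCorrLength_exponent` (`ArmExponents.lean`;
S. Smirnov, W. Werner, *Critical exponents for two-dimensional percolation*, Math. Res. Lett. 8
(2001) 729–744, Thm. 1 (iii)–(iv) of the arXiv text `math/0109120` and the paragraph following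
it: "It has been shown by Kesten [Comm. Math. Phys. 109 (1987)] that all these results hold
provided that `P[A¹_R] = R^{-5/48+o(1)}` and `P[A²_R]`(four arms)` = R^{-5/4+o(1)}`"). Theorems
only: no definition, no named fact.

Kesten's reduction, as re-proved on `𝕋` by P. Nolin (*Electron. J. Probab.* 13 (2008), §7), uses
three inputs besides the four-arm exponent: the Russo–Seymour–Welsh theory below the
characteristic length `L_ε(p)`, the exponential decay beyond `L_ε(p)` (Lemma 39), and Kesten's
scaling relation `|p - 1/2| L_ε(p)² π₄(L_ε(p)) ≍ 1` (Prop. 34). In the tree the first two are now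
unconditional (`Nolin2008_RSW_holds`, `NolinRSWProofs.lean`; `Nolin2008_lemma39_at_holds_small`,
`NearCriticalRSWStart.lean`), so that

* `triCorrLength_exponent_of_prop34` : **`fourArm_exponent → Nolin2008_prop34 → triCorrLength_exponent`**
  (no `ε`, no RSW hypothesis; the assembly `triCorrLength_exponent_of_lemma39_at'` of
  `TriCorrLengthLeaves.lean` at `ε = min ε₀ (1/4)`);

and Kesten's relation at Nolin's length follows from four named facts of W. Werner's Lecture 6
(`Nolin2008_prop34_of_facts`, `KestenScalingFromFourFacts.lean`), one of which — the half-plane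
two-arm estimate `Werner2009_halfPlane_twoArm` — is proved in the tree
(`Werner2009_halfPlane_twoArm_holds`, `HalfPlaneTwoArmRadiiNearCritical.lean`). Hence

* `triCorrLength_exponent_of_facts₄` : **`fourArm_exponent → Werner2009_fourArm_quasiMult →
  Werner2009_fourArm_lowerBound → Werner2009_pivotal_lowerBound → triCorrLength_exponent`**.

What remains for `triCorrLength_exponent_holds` is exactly: the four-arm exponent `5/4`
(`fourArm_exponent`: Smirnov–Werner Thm. 4, `j = 4`, i.e. the `SLE₆` scaling limit of the four-arm
probabilities, their `SLE₆` exponent, and the four-arm quasi-multiplicativity at `p = 1/2`; see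
`ArmExponentsFourArmProofs.lean`) and the three near-critical four-arm estimates of Kesten's arm
calculus below `L(p)` (Werner 2009, Lecture 6: Cor. 6.2, §3 third estimate, proof of Lemma 6.2),
all resting on the separation of arms (Nolin 2008, Thm. 11; Werner 2009, Prop. 6.1). The older
assemblies `triCorrLength_exponent_of_leaves₂` (from `Werner2009_lemma62`) and
`triCorrLength_exponent_of_leaves₃` remain available.

## References

* S. Smirnov, W. Werner, Critical exponents for two-dimensional percolation, *Math. Res. Lett.* 8
  (2001) 729–744; arXiv:math/0109120, Thm. 1 (iii)–(iv) and the paragraph following Thm. 1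
  [SmirnovWernerMRL2001].
* H. Kesten, Scaling relations for 2D-percolation, *Comm. Math. Phys.* 109 (1987) 109–156, Thm. 1,
  Cor. 1, (4.5) [KestenScalingCMP1987].
* P. Nolin, Near-critical percolation in two dimensions, *Electron. J. Probab.* 13 (2008)
  1562–1623, §7.2 Thm. 31, §7.3 Prop. 34, §7.4 Lemma 39, Cor. 41 (arXiv 0711.4948: Thm. 30,
  Prop. 32, Lemma 37, Cor. 39) [Nolin2008].
* W. Werner, *Lectures on two-dimensional critical percolation*, IAS/Park City Math. Ser. 16
  (2009), Lecture 6, §3, Cor. 6.2, Lemma 6.2, Lemma 6.3 [WernerPCMI2009].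

Tree: `triCorrLength_exponent_of_lemma39_at'` (`TriCorrLengthLeaves.lean`),
`Nolin2008_lemma39_at_holds_small` (`NearCriticalRSWStart.lean`), `Nolin2008_prop34_of_facts`
(`KestenScalingFromFourFacts.lean`), `Werner2009_halfPlane_twoArm_holds`
(`HalfPlaneTwoArmRadiiNearCritical.lean`). Mathlib: nothing beyond the imports of these files.
-/

noncomputable section

namespace Literature.Probability.Percolation

/-- **`ν = 4/3` from the four-arm exponent and Kesten's scaling relation alone**
(Smirnov–Werner 2001, Thm. 1 (iii)–(iv), via Kesten 1987 / Nolin 2008 §7): the RSW theory below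
`L_ε(p)` and the exponential decay beyond it are supplied by the tree
(`Nolin2008_lemma39_at_holds_small`), at `ε = min ε₀ (1/4)`. [cite: SmirnovWernerMRL2001, Thm. 1 (iii)–(iv) and the paragraph following it] [cite: Nolin2008, §7.2 Thm. 31, §7.3 Prop. 34, §7.4 Lemma 39 (arXiv 0711.4948: Thm. 30, Prop. 32, Lemma 37)] -/
theorem triCorrLength_exponent_of_prop34 (h₄ : fourArm_exponent) (hK : Nolin2008_prop34) :
    triCorrLength_exponent := by
  obtain ⟨ε₀, hε₀, h37⟩ := Nolin2008_lemma39_at_holds_small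
  exact triCorrLength_exponent_of_lemma39_at' h₄ hK (lt_min hε₀ (by norm_num : (0 : ℝ) < 1 / 4))
    (lt_of_le_of_lt (min_le_right _ _) (by norm_num)) (h37 _ (min_le_left _ _))

/-- **`ν = 4/3` from the four-arm exponent and three near-critical four-arm estimates**
(Smirnov–Werner 2001, Thm. 1 (iii)–(iv); Kesten's relation from Werner 2009, Lecture 6, with the
half-plane two-arm estimate `Werner2009_halfPlane_twoArm_holds` supplied by the tree). [cite: SmirnovWernerMRL2001, Thm. 1 (iii)–(iv) and the paragraph following it] [cite: WernerPCMI2009, Lecture 6, Cor. 6.2, §3, Lemma 6.2–6.3] [cite: Nolin2008, §7.3 Prop. 34 (arXiv 0711.4948: Prop. 32)] -/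
theorem triCorrLength_exponent_of_facts₄ (h₄ : fourArm_exponent)
    (hQM : Werner2009_fourArm_quasiMult) (hLB : Werner2009_fourArm_lowerBound)
    (hP : Werner2009_pivotal_lowerBound) : triCorrLength_exponent :=
  triCorrLength_exponent_of_prop34 h₄
    (Nolin2008_prop34_of_facts hQM hLB Werner2009_halfPlane_twoArm_holds hP)

end Literature.Probability.Percolation
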